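import Summits.BirchSwinnertonDyer.BirchSwinnertonDyer.Theorems.EisensteinPrimesBSDpOnCellCTelescopeBranchIntegralIntertwinerMember
import Literature.NumberTheory.IwasawaTheory.PruferPontryaginDual
import HarnessLib

/-!
# [telescope — width x2-p2 g23, 2026-08-30] ADAPTER-M: under (rat) `ℤ_p ↠ 𝒪 = padicCoeffIntegers ι`, the cofree module `A = F²/𝒪²` of a framed
# `ρ' : G → GL_n(𝒪)` IS `(ℚ_p/ℤ_p)ⁿ` — an additive bijection `t : (Fin n → QpModZp p) → Cofree ρ' F`, semilinear over `algebraMap ℤ_p 𝒪`, intertwining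
# the ℤ_p-matrix action `v ↦ (Σ_j (M g)ᵢⱼ • v j)` with `g •` whenever `(M g).map (algebraMap ℤ_p 𝒪) = ρ' g` (the member target of leaf N1♭'s (fd_k))
# Crux 4 `BSDpOnCellC` (stmt-BirchSwinnertonDyer-19034), line «telescope», leaf N1 (`--supports`, helper; closes nothing)

WHY (ideator bsd-idea-12 g42 COORDINATION 09:07:48Z, «ADAPTER-M stays in your cofree API lane»; T-GAL-FACTTEXT §4 (fd_k♭)): the member clause of
N1♭ / N1♭-rem (this seat's #3/#5) wants an isogeny `e : (Fin 2 → QpModZp p) →+ Cofree (D k).Δ.selfDualRep (padicCoeffField (D k).ι)`, semilinear over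
`algebraMap ℤ_[p] (padicCoeffIntegers _)`, intertwining a ℤ_p-matrix action with `(D k).Δ.selfDualCofreeRep`. Ideator g41's H3
`TelescopeBranchIntegralIntertwinerMember.exists_descent_and_integral_intertwiner` descends the member's self-dual datum to ℤ_p-matrices `M₂`
(`(M₂ g).map (algebraMap ℤ_p 𝒪) = ρ' g`) under (rat) and gives the integral intertwiner; #4 turns the intertwiner into an isogeny of `(ℚ_p/ℤ_p)²`; THIS
FILE is the last step: `(ℚ_p/ℤ_p)ⁿ ≅ Cofree ρ' F` compatibly with `M₂ ↔ ρ'`. Composition (`AddMonoidHom.comp`) with #4's isogeny then yields the `e`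
of (fd_k♭) (finite kernel by `TelescopeBranchIsogenyOfIntertwiner.finite_ker_comp_of_injective`, full range by `range_comp_of_surjective`).

CONTENT (namespace `…Theorems.TelescopeBranchCofreeMemberAdapter`; THEOREMS ONLY, the map produced as `∃ t`):
* `cofreeMk_algebraMap_eq_zero_iff` — `[algebraMap ∘ q] = 0` in `F ⁿ/𝒪ⁿ` iff every `‖q i‖ ≤ 1` (norms read in `ℚ̄_p`);
* **`exists_cofreeAdapter`** — under (rat): `∃ t : (Fin n → QpModZp p) →+ Cofree ρ' F` with (i) `t (fun i ↦ QpModZp.mk p (q i)) = cofreeMk F ρ' (algebraMap ∘ q)`,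
  (ii) `t (c • v) = algebraMap ℤ_p 𝒪 c • t v`, (iii) `t` bijective, (iv) for every `M` with `M.map (algebraMap ℤ_p 𝒪) = ρ' g`:
  `t (fun i ↦ Σ_j Mᵢⱼ • v j) = g • t v` (`= cofreeRepresentation F ρ' g (t v)`); and `finite_ker_of_injective` / `finite_quotient_of_surjective`
  (the finite-kernel / finite-cokernel currency of (fd_k)).

HONEST FRAMING: module bookkeeping; constructs no Galois representation; closes no registered stub, no crux, no summit statement; BSD is proved for no curve
by this file. No named fact, no definition, no instance, no `sorry`.
References (shape only): [cite: Greenberg1989, §1 p. 98 ("A_p = V_p/T_p … (ℚ_p/ℤ_p)^d")] [cite: EmertonPollackWeston2006, §3.1 (p. 17: K, 𝒪, the cofree module)]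
-/

set_option autoImplicit false
set_option linter.dupNamespace false

noncomputable section

open scoped Classical MatrixGroups
open Finset
open Literature.NumberTheory.EllipticCurves Literature.NumberTheory.EllipticCurves.GreenbergSelmer
  Literature.NumberTheory.EllipticCurves.ModularForms Literature.NumberTheory.GaloisRepresentations Literature.NumberTheory.IwasawaTheory

namespace Summit.BirchSwinnertonDyer.BirchSwinnertonDyer.Theorems.TelescopeBranchCofreeMemberAdapter

universe u

variable {Γ₀ : Subgroup (GL (Fin 2) ℝ)} {k : ℤ} {g : CuspForm Γ₀ k} {p : ℕ} [Fact p.Prime] (ι : coeffField g →+* PadicAlgCl p)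
  {G : Type u} [Group G] [TopologicalSpace G] {n : ℕ}

/-! ## §1 The lattice `𝒪ⁿ ⊆ Fⁿ` seen from `ℚ_pⁿ` -/

/-- `((algebraMap ℤ_p 𝒪 c : 𝒪) : F) = algebraMap ℚ_p F c` (the two ways from `ℤ_p` to `F = ℚ_p(ι K_g)`). [cite: EmertonPollackWeston2006, §3.1 (p. 17)] -/
theorem coe_algebraMap_padicInt (c : ℤ_[p]) :
    ((algebraMap ℤ_[p] (padicCoeffIntegers ι) c : padicCoeffIntegers ι) : padicCoeffField ι) = algebraMap ℚ_[p] (padicCoeffField ι) (c : ℚ_[p]) := by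
  rw [padicCoeffIntegers.algebraMap_padicInt_eq, padicCoeffIntegers.coe_ofPadicInt]

/-- **`[algebraMap ∘ q] = 0` in `Fⁿ/𝒪ⁿ` iff `‖q i‖ ≤ 1` for all `i`** (an element of `ℚ_p ⊆ F` lies in `𝒪` iff its `ℚ̄_p`-norm is `≤ 1`).
[cite: EmertonPollackWeston2006, §3.1 (p. 17: 𝒪 the ring of integers of K)] -/
theorem cofreeMk_algebraMap_eq_zero_iff (ρ' : FramedRep G (padicCoeffIntegers ι) n) (q : Fin n → ℚ_[p]) :
    cofreeMk (padicCoeffField ι) ρ' (fun i ↦ algebraMap ℚ_[p] (padicCoeffField ι) (q i)) = 0 ↔ ∀ i, ‖q i‖ ≤ 1 := by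
  rw [← LinearMap.mem_ker, ker_cofreeMk, mem_lattice_iff]
  constructor
  · rintro ⟨y, hy⟩ i
    have hi := congr_fun hy i
    rw [← norm_coe_algebraMap_padic ι (q i), ← hi]
    exact norm_toPadicAlgCl_le_one ι (y i)
  · intro h
    refine ⟨fun i ↦ algebraMap ℤ_[p] (padicCoeffIntegers ι) ⟨q i, h i⟩, funext fun i ↦ ?_⟩
    change ((algebraMap ℤ_[p] (padicCoeffIntegers ι) ⟨q i, h i⟩ : padicCoeffIntegers ι) : padicCoeffField ι) = _
    rw [coe_algebraMap_padicInt]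

/-- `algebraMap 𝒪 F` is the coercion. [folklore] -/
theorem algebraMap_coeffIntegers_apply (y : padicCoeffIntegers ι) :
    algebraMap (padicCoeffIntegers ι) (padicCoeffField ι) y = (y : padicCoeffField ι) := rfl

/-! ## §2 The adapter -/

/-- Finite kernel from injectivity (the (fd_k) currency). [folklore] -/
theorem finite_ker_of_injective {A B : Type*} [AddCommGroup A] [AddCommGroup B] (t : A →+ B) (ht : Function.Injective t) :
    Finite t.ker := by
  rw [(AddMonoidHom.ker_eq_bot_iff t).mpr ht]
  infer_instance

/-- Finite cokernel from surjectivity (the (fd_k) currency). [folklore] -/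
theorem finite_quotient_of_surjective {A B : Type*} [AddCommGroup A] [AddCommGroup B] (t : A →+ B) (ht : Function.Surjective t) :
    Finite (B ⧸ t.range) := by
  rw [AddMonoidHom.range_eq_top.mpr ht]
  infer_instance

set_option maxHeartbeats 800000 in
/-- **ADAPTER-M.** Under (rat) `Function.Surjective (algebraMap ℤ_[p] 𝒪)`, `𝒪 = padicCoeffIntegers ι`, `F = padicCoeffField ι`, for every framed
`ρ' : G → GL_n(𝒪)` THERE IS an additive `t : (Fin n → ℚ_p/ℤ_p) → Cofree ρ' F = Fⁿ/𝒪ⁿ` with: (i) `t ([q i])_i = [(algebraMap ℚ_p F (q i))_i]`;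
(ii) `t (c • v) = algebraMap ℤ_p 𝒪 c • t v`; (iii) `t` injective and surjective; (iv) for every `ℤ_p`-matrix `M` with `M.map (algebraMap ℤ_p 𝒪) = ρ' g`:
`t (fun i ↦ Σ_j Mᵢⱼ • v j) = g • t v` (`g •` = `cofreeRepresentation F ρ' g`, the action of the tree's `Cofree`). The member target of leaf N1♭'s (fd_k).
[cite: Greenberg1989, §1 p. 98] [cite: EmertonPollackWeston2006, §3.1 (p. 17)] -/
theorem exists_cofreeAdapter (hrat : Function.Surjective (algebraMap ℤ_[p] (padicCoeffIntegers ι)))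
    (ρ' : FramedRep G (padicCoeffIntegers ι) n) :
    ∃ t : (Fin n → QpModZp p) →+ Cofree ρ' (padicCoeffField ι),
      (∀ q : Fin n → ℚ_[p], t (fun i ↦ QpModZp.mk p (q i)) =
        cofreeMk (padicCoeffField ι) ρ' (fun i ↦ algebraMap ℚ_[p] (padicCoeffField ι) (q i))) ∧
      (∀ (c : ℤ_[p]) (v : Fin n → QpModZp p), t (c • v) = algebraMap ℤ_[p] (padicCoeffIntegers ι) c • t v) ∧
      Function.Injective t ∧ Function.Surjective t ∧
      ∀ (g : G) (M : Matrix (Fin n) (Fin n) ℤ_[p]),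
        M.map (algebraMap ℤ_[p] (padicCoeffIntegers ι)) =
          ((ρ' g : GL (Fin n) (padicCoeffIntegers ι)) : Matrix (Fin n) (Fin n) (padicCoeffIntegers ι)) →
        ∀ v : Fin n → QpModZp p, t (fun i ↦ ∑ j, M i j • v j) = g • t v := by
  -- the componentwise projection `π : ℚ_pⁿ → (ℚ_p/ℤ_p)ⁿ` and the lift candidate `ψ : ℚ_pⁿ → Fⁿ/𝒪ⁿ`
  let π : (Fin n → ℚ_[p]) →ₗ[ℤ_[p]] (Fin n → QpModZp p) := (Submodule.mkQ (1 : Submodule ℤ_[p] ℚ_[p])).compLeft (Fin n)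
  have hπ : ∀ q i, π q i = QpModZp.mk p (q i) := fun _ _ ↦ rfl
  have hπsurj : Function.Surjective π := by
    intro v
    choose q hq using fun i ↦ Submodule.Quotient.mk_surjective (1 : Submodule ℤ_[p] ℚ_[p]) (v i)
    exact ⟨q, funext fun i ↦ hq i⟩
  let ψ : (Fin n → ℚ_[p]) →+ Cofree ρ' (padicCoeffField ι) :=
    (cofreeMk (padicCoeffField ι) ρ').toAddMonoidHom.comp
      (((algebraMap ℚ_[p] (padicCoeffField ι)).toAddMonoidHom).compLeft (Fin n))
  have hψ : ∀ q, ψ q = cofreeMk (padicCoeffField ι) ρ' (fun i ↦ algebraMap ℚ_[p] (padicCoeffField ι) (q i)) := fun _ ↦ rfl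
  have hker : π.toAddMonoidHom.ker ≤ ψ.ker := by
    intro q hq
    rw [AddMonoidHom.mem_ker] at hq ⊢
    rw [hψ, cofreeMk_algebraMap_eq_zero_iff]
    intro i
    have := congr_fun hq i
    rw [LinearMap.toAddMonoidHom_coe, hπ, Pi.zero_apply, QpModZp.mk_eq_zero_iff] at this
    exact this
  -- the lift
  obtain ⟨s, hs⟩ : ∃ s : (Fin n → QpModZp p) → (Fin n → ℚ_[p]), Function.RightInverse s π.toAddMonoidHom :=
    ⟨Function.surjInv hπsurj, Function.rightInverse_surjInv hπsurj⟩
  let t : (Fin n → QpModZp p) →+ Cofree ρ' (padicCoeffField ι) := (π.toAddMonoidHom.liftOfRightInverse s hs) ⟨ψ, hker⟩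
  have ht : ∀ q, t (π q) = ψ q := fun q ↦ π.toAddMonoidHom.liftOfRightInverse_comp_apply s hs ⟨ψ, hker⟩ q
  have ht' : ∀ q : Fin n → ℚ_[p],
      t (fun i ↦ QpModZp.mk p (q i)) = cofreeMk (padicCoeffField ι) ρ' (fun i ↦ algebraMap ℚ_[p] (padicCoeffField ι) (q i)) :=
    fun q ↦ by change t (π q) = _; rw [ht, hψ]
  refine ⟨t, ht', fun c v ↦ ?_, fun v w hvw ↦ ?_, fun a ↦ ?_, fun g₀ M hM v ↦ ?_⟩
  · -- (ii) semilinearity over `ℤ_p → 𝒪`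
    obtain ⟨q, rfl⟩ := hπsurj v
    rw [← map_smul, ht, ht, hψ, hψ, ← map_smul]
    congr 1
    funext i
    rw [Pi.smul_apply, Pi.smul_apply, Algebra.smul_def, Algebra.smul_def, map_mul, PadicInt.algebraMap_apply,
      ← coe_algebraMap_padicInt]
    rfl
  · -- (iii) injective
    obtain ⟨q, rfl⟩ := hπsurj v
    obtain ⟨q', rfl⟩ := hπsurj w
    rw [← sub_eq_zero, ← map_sub, ← map_sub, ht, hψ] at hvw
    rw [← sub_eq_zero, ← map_sub]
    funext i
    rw [hπ, Pi.zero_apply, QpModZp.mk_eq_zero_iff]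
    exact (cofreeMk_algebraMap_eq_zero_iff ι ρ' (q - q')).mp hvw i
  · -- (iii) surjective (uses (rat): `ℚ_p → F` is onto)
    obtain ⟨y, rfl⟩ := cofreeMk_surjective (padicCoeffField ι) ρ' a
    choose q hq using fun i ↦ (TelescopeBranchIntegralIntertwinerMember.bijective_algebraMap_padicCoeffField ι hrat).2 (y i)
    refine ⟨π q, ?_⟩
    rw [ht, hψ]
    congr 1
    funext i
    exact hq i
  · -- (iv) equivariance: `t (M · v) = g • t v` when `M` lifts `ρ' g`
    obtain ⟨q, rfl⟩ := hπsurj v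
    have h1 : (fun i ↦ ∑ j, M i j • π q j) = π (fun i ↦ ∑ j, (M i j : ℚ_[p]) * q j) := by
      funext i
      change ∑ j, M i j • (Submodule.mkQ (1 : Submodule ℤ_[p] ℚ_[p])) (q j) =
        (Submodule.mkQ (1 : Submodule ℤ_[p] ℚ_[p])) (∑ j, (M i j : ℚ_[p]) * q j)
      rw [map_sum]
      exact Finset.sum_congr rfl fun j _ ↦ QpModZp.smul_mk p (M i j) (q j)
    rw [h1, ht, ht, hψ, hψ, smul_cofreeMk, fracRepresentation_apply_apply, ← hM]
    congr 1
    funext i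
    rw [map_sum, Matrix.mulVec, dotProduct]
    refine Finset.sum_congr rfl fun j _ ↦ ?_
    rw [map_mul, Matrix.map_apply, Matrix.map_apply, algebraMap_coeffIntegers_apply, coe_algebraMap_padicInt]

end Summit.BirchSwinnertonDyer.BirchSwinnertonDyer.Theorems.TelescopeBranchCofreeMemberAdapter

end
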